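/-
Origin: expansion seat `planner-pub-hodgecm-pv12-g8-0`, handover #4 v2 md5 90fa3c487c7c590a8eef5ba058aead5c (82 l., 5 decls; v2 = doc-only SUPERSEDES 453b08a2); NEW additive leaf; sole import Pv12g8.FockPrintGenuineKappa (ONE rewrite ^import Pv12g8\.FockPrintGenuineKappa -> import HodgeCM.PerL34.FockPrintGenuineKappa); LAND AFTER this seat's #3 FockPrintGenuineKappa v2 927eb582; HOLD iff #3 is held (`HOME/pub-hodgecm-pv12-g8/lean/Pv12g8/FockPrintTorusBasis.lean`, md5 90fa3c48, 82 lines);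
landed by the gen-8 packager in gate run 30 as `HodgeCM/PerL34/FockPrintTorusBasis.lean` (import ^import Pv12g8\.FockPrintGenuineKappa[ \t]*$→import HodgeCM.PerL34.FockPrintGenuineKappa ×1).
-/
/-
Copyright (c) 2026. Released under the Apache-2.0 license.
-/
import Summits.HodgeConjecture.HodgeCM.PerL34.FockPrintGenuineKappa_2

/-!
# The genuine printed tori are DIAGONAL on the orthonormal Hermite basis of `𝓕 ⊂ L²(ℂ^σ)` (node N26/N29 follow-up)

Origin: speedrun cell `pub-hodgecm`, seat pv12-g8 (Fock-model seat), node #4.  KERNEL leaf; imports this seat's #3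
(`FockPrintGenuineKappa`, for `torusU_eq_diagHom`) and through it the r29 TREE modules `FockPrintGenuineTorus` (pv12-g7)
and `FockInvariantLines` (pv05-g6), whose theorems are consumed BY NAME; zero hypothesis structures, zero citations used
as hypotheses.

* `fockRep_torusU_fockBasis`: RUN 29's genuine one-parameter torus `torusU s : U(1) → U(σ)` (Folland's `ν₀`,
  `F ↦ F ∘ U⁻¹` on `L²`, restricted to a diagonal torus) acts on the orthonormal basis vector
  `fockBasis β = ζ_β·e^{−(π/2)|z|²}` of the genuine Hilbert space by the character `u ↦ u^{wt s β}`, where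
  `wt s β = Σ_k s_k β_k` is EXACTLY the eigenvalue of the printed weight operator `weightOp s` on the monomial `z^β`
  (`FockKTypes.weightOp_monomial`).
* `torusChar_torusWeights`: pv05-g6's abstract torus character `torusChar β` evaluated on the printed torus IS
  `u^{wt s β}` — so the two r29 files describe one spectral decomposition.
* `fockBasis_repr_torusU`: in `HilbertBasis` coordinates, on ALL of `𝓕` (not only the polynomial core):
  `⟪ζ_β, ν₀(torusU s u) G⟫ = u^{wt s β} ⟪ζ_β, G⟫`.

So the package's printed weight bookkeeping (`weightOp`, `wt`; the row/column/`w` weights of `ArchB`) IS the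
spectral decomposition of an honest unitary torus representation on an honest orthonormal basis — a KERNEL identity,
no convention involved at this level; for the plane model's `T_{ι₁} = U(W₁) × U(W₂)` (`planeTorusHom` of
`FockPrintGenuineTorus`) see `fockRep_planeTorusHom_fockBasis`.  PRECISION (as in `FockPrintGenuineKappa`'s header,
referee adv2-g37): the identification of these genuine characters / package labels with PerL's PRINTED half-integral
labels of ll. 505–511 (vacuum shifts; the `det^{·/2}` covers of [Ad07] §6 II) is NOT proved here and remains the
standing N26 CONVENTION record (GAPS.md X6 / l. 6703); nothing below uses it.
-/

set_option autoImplicit false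

open MvPolynomial Complex
open scoped ComplexConjugate

namespace HodgeCM.PerL34.Fock.PrintDict

section General

variable {σ : Type*} [Fintype σ] [DecidableEq σ]

/-- `weightOp s` on the normalised monomial `ζ_β`: eigenvalue `wt s β`. -/
theorem weightOp_zeta (s : σ → ℤ) (β : σ →₀ ℕ) :
    weightOp s (Hermite.zeta β) = ((wt s β : ℤ) : ℂ) • Hermite.zeta β := by
  rw [Hermite.zeta, map_smul, weightOp_monomial, smul_comm]

/-- **The genuine torus `torusU s` is diagonal on the orthonormal basis (KERNEL):**
`ν₀(torusU s u) (ζ_β e^{−(π/2)|z|²}) = u^{wt s β} · (ζ_β e^{−(π/2)|z|²})` in `L²(ℂ^σ)`. -/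
theorem fockRep_torusU_fockBasis (s : σ → ℤ) (u : Circle) (β : σ →₀ ℕ) :
    Hermite.fockRep (torusU s u) (Hermite.fockBasis β : Hermite.FockL2 σ)
      = ((u ^ wt s β : Circle) : ℂ) • (Hermite.fockBasis β : Hermite.FockL2 σ) := by
  rw [Hermite.fockBasis_apply, ← Hermite.fockToL2_zeta]
  exact fockRep_torusU_fockToL2_of_weightOp s (weightOp_zeta s β) u

/-- pv05-g6's torus character on the printed torus: `torusChar β (k ↦ (u^{s k})⁻¹) = u^{wt s β}`. -/
theorem torusChar_torusWeights (s : σ → ℤ) (u : Circle) (β : σ →₀ ℕ) :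
    Hermite.torusChar β (fun k => (u ^ s k)⁻¹) = ((u ^ wt s β : Circle) : ℂ) := by
  have h1 := fockRep_torusU_fockBasis s u β
  rw [torusU_eq_diagHom, Hermite.fockRep_diagHom_fockBasis] at h1
  exact smul_left_injective ℂ (Hermite.fockBasis.orthonormal.ne_zero β) h1

/-- **In `HilbertBasis` coordinates, on ALL of `𝓕`:** `⟪ζ_β, ν₀(torusU s u) G⟫ = u^{wt s β} ⟪ζ_β, G⟫`. -/
theorem fockBasis_repr_torusU (s : σ → ℤ) (u : Circle) (G : Hermite.FockL2 σ) (β : σ →₀ ℕ) :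
    Hermite.fockBasis.repr (Hermite.fockRep (torusU s u) G) β
      = ((u ^ wt s β : Circle) : ℂ) * Hermite.fockBasis.repr G β := by
  rw [torusU_eq_diagHom, Hermite.fockBasis_repr_diagHom, torusChar_torusWeights]

end General

/-! ## The plane model's `T_{ι₁} = U(W₁) × U(W₂)` -/

/-- `planeTorusHom (u₁, u₂)` acts on `ζ_β e^{−(π/2)|z|²}` by `u₁^{wt (colWt 0) β} u₂^{wt (colWt 1) β}`. -/
theorem fockRep_planeTorusHom_fockBasis (u : Circle × Circle) (β : PlaneVar →₀ ℕ) :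
    Hermite.fockRep (planeTorusHom u) (Hermite.fockBasis β : Hermite.FockL2 PlaneVar)
      = (((u.1 ^ wt (colWt 0) β * u.2 ^ wt (colWt 1) β : Circle)) : ℂ)
          • (Hermite.fockBasis β : Hermite.FockL2 PlaneVar) := by
  rw [planeTorusHom_apply, map_mul, LinearIsometryEquiv.coe_mul, Function.comp_apply, fockRep_torusU_fockBasis,
    LinearIsometryEquiv.map_smul, fockRep_torusU_fockBasis, smul_smul, Circle.coe_mul, mul_comm]

end HodgeCM.PerL34.Fock.PrintDict
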